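/-
HONEST FRAMING: systematic search; no irrationality claim unless certified.
-/
import Summits.KontsevichZagierPeriods.Zeta5Search.RVJetShift
import HarnessLib

/-!
# RV family, generation 14.3 — the deflated data, their moment vector `M = (0, 0, D, 0, 0, 0)`, and `Q` in closed form on the two smallest windows

HONEST FRAMING: systematic search; no irrationality claim unless certified.  Nothing in this file is about integrals or
irrationality: it is exact linear algebra on the six-order partial-fraction data of `RVCasoratianNormalForm` (13.1,
`shiftData`, `isPFData_shift`, `sum_order_zero_of_isPFData`) and `RVJetShift` (14.2, `rawSum`, `rawDeflW`, `rawMinorQ`,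
`jetOp`, `rawSum_pfData_odd`, `rawSum_coreData_odd`).

The DEFLATED DATA of an index `b` are `d := core − r_U · c` (`deflData`), where `c = pfData b`, `core = shiftData b₀ 0 c`
(the data of `y(y + b₀)·R_b`) and `r_U = U^core / U`; they are the data of `S_b := (y(y + b₀) − r_U)·R_b`, the combination
that kills the top functional `U`.  Their TOTAL MOMENTS `M_o := Σ_q d_{o,q}` (`rawSum`) satisfy, on the Brown–Zudilin
polytope with one admissible partner and `U(b) ≠ 0`,

  `M_o = 0` for `o ∈ {0, 1, 3, 4, 5}` (`deflMoment_eq_zero`),   `M_2 = D := W^core − r_U·W` (`deflMoment_two`),   `U·D = Q` (`rawSum_four_mul_rawDeflW`):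

* `M_4 = 0` is the definition of `r_U` (`rawSum_deflData_four`);
* `M_1 = M_3 = M_5 = 0` are the odd-order (`ζ(2)/ζ(4)/ζ(6)`-coefficient) vanishings of 14.2;
* `M_0 = 0` is the residue theorem under the degree margin — `sum_order_zero_of_isPFData` (13.1) for `c`
  (`rawSum_pfData_zero`) and, through the transport `isPFData_shift` + `shiftData_eq`, for `core` (`rawSum_coreData_zero`).

Why it matters (gen14/HANDOFF.md §G15-PREP, P1 "Λ-elimination"): the truncated jet operator `T_t = jetOp t` of 14.2 moves
moments by `S_o(T_t c) = Σ_{k<6−o} t_k S_{o+k}(c)` (`rawSum_jetOp`), so a functional of the data that is a fixed moment of a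
`T_t`-equivariant combination only sees the HIGHER moments of that combination; for the deflated data all of them vanish
above order 2, which is the moment-level reason why `D` (hence `Q = U·D`, the pivot of 14.1's law (PQ)) is blind to the
common logarithmic jets — the terms every termwise bound of gens 11–14 had to pay for.  On the `V` side the same vector
says that the window residue sum `Σ_q κ_q^{o}…` feels a common second-jet shift only through `D` (not formalised here).

Part E (WINDOW NORMAL FORMS) makes the first step of the 'symbolic engine' of §G15-PREP P2 a theorem: for data whose
coefficients of order `≥ 2` live on ONE column of order `5`, `Q = c₄² + (n − 2q₀)c₄c₃` (`rawMinorQ_single_pole_five`; `= U²`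
when that column is the centre, `rawMinorQ_single_centre_pole_five`), and on a MIRROR PAIR of order-`6` columns with the
Brown–Zudilin reflection symmetry `c_{o,q̄} = (−1)^o c_{o,q}`, `Q = 4(c₄² + (n − 2q₁)(c₃c₄ − c₂c₅))` (`rawMinorQ_mirror_pair_six`)
— in jet coordinates `Q/A² = 4λ₁² + (8κ/3)λ₁³ − 8κλ₃`, odd jets only.  These two shapes cover 128 of the 1,779 uniform types
of the `p = 7` residual regime (exact agreement on all of them, gen14 `uX15`/HANDOFF P2); the general window is the same
finite Bell-polynomial algebra.

All statements are exact identities over `ℚ`; no valuation, prime or conjecture node occurs in this file.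
-/

noncomputable section

open Finset

namespace Summit.KontsevichZagierPeriods.Zeta5Search.RVFlatGauge

open Summit.KontsevichZagierPeriods.Zeta5Search.DualSeries (InBox)
open Summit.KontsevichZagierPeriods.Zeta5Search.WedgeDictionary (IsPFData pfData isPFData_pfData exists_isPFData
  sum_pfData_odd coeffU coeffW)
open Summit.KontsevichZagierPeriods.Zeta5Search.CasoratianValuation (shift InPolytope)
open Summit.KontsevichZagierPeriods.Zeta5Search.BigPrime (shift_zero polytope_hyps)

/-! ### Deflated data and their moments (arbitrary six-order data) -/

/-- Deflated data `d_{o,q} = core_{o,q} − r_U · c_{o,q}` with `core = shiftData n 0 c` and `r_U = S₄(core)/S₄(c)`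
(sums cut at `N`): the data of `(y(y+n) − r_U)·F`. -/
def deflData (N : ℕ) (n : ℚ) (c : ℕ → ℕ → ℚ) (o q : ℕ) : ℚ :=
  shiftData n 0 c o q - rawSum N 4 (shiftData n 0 c) / rawSum N 4 c * c o q

/-- Moments of the deflated data: `M_o = S_o(core) − r_U · S_o(c)`. -/
theorem rawSum_deflData (N : ℕ) (n : ℚ) (c : ℕ → ℕ → ℚ) (o : ℕ) :
    rawSum N o (deflData N n c) =
      rawSum N o (shiftData n 0 c) - rawSum N 4 (shiftData n 0 c) / rawSum N 4 c * rawSum N o c := by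
  simp only [rawSum, deflData, sum_sub_distrib, ← mul_sum]

/-- `M_2 = D` (the deflated `W`-sum of 14.2). -/
theorem rawSum_deflData_two (N : ℕ) (n : ℚ) (c : ℕ → ℕ → ℚ) : rawSum N 2 (deflData N n c) = rawDeflW N n c := by
  rw [rawSum_deflData]
  rfl

/-- `M_4 = 0`: deflation kills the top functional (`S₄(c) ≠ 0`). -/
theorem rawSum_deflData_four (N : ℕ) (n : ℚ) (c : ℕ → ℕ → ℚ) (hU : rawSum N 4 c ≠ 0) :
    rawSum N 4 (deflData N n c) = 0 := by
  rw [rawSum_deflData, div_mul_cancel₀ _ hU, sub_self]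

/-- `U · D = Q`: the top functional times the deflated `W`-sum is the harmonic-free minor of 13.1/14.2 (`S₄(c) ≠ 0`). -/
theorem rawSum_four_mul_rawDeflW (N : ℕ) (n : ℚ) (c : ℕ → ℕ → ℚ) (hU : rawSum N 4 c ≠ 0) :
    rawSum N 4 c * rawDeflW N n c = rawMinorQ N n c := by
  have key := div_mul_cancel₀ (rawSum N 4 (shiftData n 0 c)) hU
  unfold rawDeflW rawMinorQ
  linear_combination (-(rawSum N 2 c)) * key

/-- Moments under the truncated jet operator of 14.2: `S_o(T_t c) = Σ_{k<6−o} t_k · S_{o+k}(c)` (`o < 6`). -/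
theorem rawSum_jetOp (N : ℕ) (t : ℕ → ℚ) (c : ℕ → ℕ → ℚ) {o : ℕ} (ho : o < 6) :
    rawSum N o (jetOp t c) = ∑ k ∈ range (6 - o), t k * rawSum N (o + k) c := by
  unfold rawSum jetOp
  simp only [ho, if_true]
  rw [sum_comm]
  simp only [mul_sum]

/-- The jet operator is linear in the data: `T_t(a − r·c) = T_t a − r·T_t c` pointwise. -/
theorem jetOp_sub_mul (t : ℕ → ℚ) (a c : ℕ → ℕ → ℚ) (r : ℚ) (o q : ℕ) :
    jetOp t (fun o' q' => a o' q' - r * c o' q') o q = jetOp t a o q - r * jetOp t c o q := by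
  unfold jetOp
  split_ifs with ho
  · rw [mul_sum, ← sum_sub_distrib]
    exact sum_congr rfl fun k _ => by ring
  · rfl

/-- The deflated data depend linearly on `(core, c)` for FIXED `r`: `d = core − r·c` pointwise, so the jet operator — which
commutes with `shiftData` (14.2) — acts on `d` as on `c` whenever it fixes `r_U` (hypothesis `hr`; it does when `t₁ = 0` or the
order-five sums vanish, `rawSum_four_jetOp`). -/
theorem deflData_jetOp (N : ℕ) (n : ℚ) (t : ℕ → ℚ) (c : ℕ → ℕ → ℚ)
    (hr : rawSum N 4 (shiftData n 0 (jetOp t c)) / rawSum N 4 (jetOp t c) = rawSum N 4 (shiftData n 0 c) / rawSum N 4 c) :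
    deflData N n (jetOp t c) = jetOp t (deflData N n c) := by
  funext o q
  have h := jetOp_sub_mul t (shiftData n 0 c) c (rawSum N 4 (shiftData n 0 c) / rawSum N 4 c) o q
  unfold deflData
  rw [hr, shiftData_jetOp, h]

/-! ### On the polytope: the order-zero sums (residue theorem) -/

/-- Order-zero coefficients of `pfData b` sum to zero on the polytope (13.1 `sum_order_zero_of_isPFData`). -/
theorem rawSum_pfData_zero (b : ℕ → ℤ) (hb : InPolytope b) : rawSum (b 0).toNat 0 (pfData b) = 0 := by
  obtain ⟨hbox, -, hsum⟩ := polytope_hyps b hb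
  obtain ⟨c, hc⟩ := exists_isPFData b hbox hsum
  exact sum_order_zero_of_isPFData b hbox hsum (isPFData_pfData hc)

/-- Order-zero coefficients of the CORE data sum to zero on the polytope with one admissible partner `b + e_j`
(transport 13.1 applied to the partner, then `shiftData_eq`). -/
theorem rawSum_coreData_zero (b : ℕ → ℤ) (hb : InPolytope b) (hj : ∃ j, 1 ≤ j ∧ j ≤ 7 ∧ InPolytope (shift b j)) :
    rawSum (b 0).toNat 0 (shiftData (b 0) 0 (pfData b)) = 0 := by
  obtain ⟨hbox, -, hsum⟩ := polytope_hyps b hb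
  obtain ⟨j, hj1, hj7, hbj⟩ := hj
  obtain ⟨hbox', -, hsum'⟩ := polytope_hyps _ hbj
  obtain ⟨c, hc⟩ := exists_isPFData b hbox hsum
  have hs := isPFData_shift b hbox hsum hj1 hj7 (isPFData_pfData hc)
  have h0' := sum_order_zero_of_isPFData (shift b j) hbox' hsum' hs
  rw [shift_zero b hj1] at h0'
  have hb' := rawSum_pfData_zero b hb
  unfold rawSum at hb' ⊢
  have key : ∀ q, shiftData ((b 0 : ℤ) : ℚ) 0 (pfData b) 0 q =
      shiftData ((b 0 : ℤ) : ℚ) (b j) (pfData b) 0 q - (b j : ℚ) * ((b 0 : ℤ) - (b j : ℚ)) * pfData b 0 q := by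
    intro q
    rw [shiftData_eq ((b 0 : ℤ) : ℚ) (b j) (pfData b) 0 q]
    ring
  simp_rw [key, sum_sub_distrib, ← mul_sum, h0', hb', mul_zero, sub_zero]

/-! ### The moment vector of the deflated data of `b` -/

/-- **THE MOMENT VECTOR, vanishing part**: every total moment of order `o ∈ {0, 1, 3, 4, 5}` of the deflated data of `b`
vanishes (polytope, one admissible partner, `U(b) ≠ 0`). -/
theorem deflMoment_eq_zero (b : ℕ → ℤ) (hb : InPolytope b) (hj : ∃ j, 1 ≤ j ∧ j ≤ 7 ∧ InPolytope (shift b j))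
    (hU : coeffU b ≠ 0) {o : ℕ} (ho : o < 6) (ho2 : o ≠ 2) :
    rawSum (b 0).toNat o (deflData (b 0).toNat (b 0) (pfData b)) = 0 := by
  rw [coeffU_eq_rawSum] at hU
  obtain rfl | rfl | rfl | rfl | rfl : o = 0 ∨ o = 1 ∨ o = 3 ∨ o = 4 ∨ o = 5 := by omega
  · rw [rawSum_deflData, rawSum_coreData_zero b hb hj, rawSum_pfData_zero b hb, mul_zero, sub_zero]
  · rw [rawSum_deflData, rawSum_coreData_odd b hb hj (o := 1) (by norm_num) ⟨0, by norm_num⟩,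
      rawSum_pfData_odd b hb (o := 1) (by norm_num) ⟨0, by norm_num⟩, mul_zero, sub_zero]
  · rw [rawSum_deflData, rawSum_coreData_odd b hb hj (o := 3) (by norm_num) ⟨1, by norm_num⟩,
      rawSum_pfData_odd b hb (o := 3) (by norm_num) ⟨1, by norm_num⟩, mul_zero, sub_zero]
  · exact rawSum_deflData_four _ _ _ hU
  · rw [rawSum_deflData, rawSum_coreData_odd b hb hj (o := 5) (by norm_num) ⟨2, by norm_num⟩,
      rawSum_pfData_odd b hb (o := 5) (by norm_num) ⟨2, by norm_num⟩, mul_zero, sub_zero]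

/-- **THE MOMENT VECTOR, order two**: `M_2(b) = D(b) = W^core − r_U·W` — the only surviving moment. -/
theorem deflMoment_two (b : ℕ → ℤ) :
    rawSum (b 0).toNat 2 (deflData (b 0).toNat (b 0) (pfData b)) = rawDeflW (b 0).toNat (b 0) (pfData b) :=
  rawSum_deflData_two _ _ _

/-- `U(b) · D(b) = Q(b)` (`minorQCore` of 13.1), for `U(b) ≠ 0`. -/
theorem coeffU_mul_deflW (b : ℕ → ℤ) (hU : coeffU b ≠ 0) :
    coeffU b * rawDeflW (b 0).toNat (b 0) (pfData b) = minorQCore b := by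
  rw [minorQCore_eq_rawMinorQ, coeffU_eq_rawSum] at *
  exact rawSum_four_mul_rawDeflW _ _ _ hU

/-- **Jet-invariance of `D` read off the moment vector**: for a jet operator with `t₀ = 1` on the polytope with a partner,
`D(T_t·pfData b) = M_2 + t_1 M_3 + t_2 M_4 + t_3 M_5 = D(b)` — a second route to 14.2's `deflW_jetOp_invariant`, here as the
statement that the order-two moment of the jet-moved deflated data is unchanged. -/
theorem deflMoment_two_jetOp (b : ℕ → ℤ) (hb : InPolytope b) (hj : ∃ j, 1 ≤ j ∧ j ≤ 7 ∧ InPolytope (shift b j))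
    (hU : coeffU b ≠ 0) (t : ℕ → ℚ) (ht : t 0 = 1) :
    rawSum (b 0).toNat 2 (jetOp t (deflData (b 0).toNat (b 0) (pfData b))) =
      rawDeflW (b 0).toNat (b 0) (pfData b) := by
  rw [rawSum_jetOp _ _ _ (by norm_num : 2 < 6)]
  simp only [show (6 : ℕ) - 2 = 4 by norm_num, sum_range_succ, sum_range_zero, zero_add,
    show 2 + 0 = 2 by norm_num, show 2 + 1 = 3 by norm_num, show 2 + 2 = 4 by norm_num, show 2 + 3 = 5 by norm_num]
  rw [deflMoment_two, deflMoment_eq_zero b hb hj hU (by norm_num) (by norm_num),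
    deflMoment_eq_zero b hb hj hU (by norm_num) (by norm_num) (o := 4),
    deflMoment_eq_zero b hb hj hU (by norm_num) (by norm_num) (o := 5), ht]
  ring

/-! ## Part E — window normal forms: `Q` in closed form for the two smallest window shapes

The functionals `U = S₄`, `W = S₂`, `U^core`, `W^core` only see the columns carrying coefficients of order `≥ 2`
(the WINDOW).  For the two smallest window shapes met on the residual regime the minor `Q` is an explicit polynomial
in the window entries — and, read through the logarithmic jets `c_{top−k} = A·e_k(λ)`, a polynomial in the ODD jets
`λ₁, λ₃` only (the even jet `λ₂ ∋ Λ` cancels, as Part C predicts):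
* ONE column `q₀` of order `5` (`c_{5,q₀} = 0`): `Q = c₄² + (n − 2q₀)·c₄c₃`; on the polytope the lone top pole is the
  centre (`n = 2q₀`), so `Q = U²` there (all 80 such uniform types at `p = 7` have `D = A`, i.e. `X ≡ 1`);
* a MIRROR PAIR `q₁ + q₂ = n` of order-`6` columns with `c_{o,q₂} = (−1)^o c_{o,q₁}` (the reflection symmetry of
  Brown–Zudilin data): `Q = 4·(c₄² + (n − 2q₁)(c₃c₄ − c₂c₅))`, i.e. `Q/A² = 4λ₁² + (8κ/3)λ₁³ − 8κλ₃` with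
  `2κ = n − 2q₁` (all 48 such types; e.g. the family `(2p+1; p⁵; 0,0)`: `λ₁ = −(3p+4)/(p+1)`, `λ₃ = 1 − 1/(3(p+1)³)`,
  `D/A = 2(p+2)(p+3)/((p+1)(3p+4))` — gen14/HANDOFF.md §G15-PREP P2). -/
section WindowNormalForms

/-- A raw functional of data supported (at order `o`) on the single column `q₀ ≤ N` is that entry. -/
theorem rawSum_eq_of_support_single {N o q₀ : ℕ} {c : ℕ → ℕ → ℚ} (hq : q₀ ≤ N)
    (hc : ∀ q, q ≠ q₀ → c o q = 0) : rawSum N o c = c o q₀ := by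
  unfold rawSum
  exact sum_eq_single_of_mem q₀ (mem_range.2 (Nat.lt_succ_of_le hq)) fun q _ hne => hc q hne

/-- A raw functional of data supported (at order `o`) on two columns `q₁ ≠ q₂` (both `≤ N`) is the sum of the two entries. -/
theorem rawSum_eq_of_support_pair {N o q₁ q₂ : ℕ} {c : ℕ → ℕ → ℚ} (h₁ : q₁ ≤ N) (h₂ : q₂ ≤ N) (hne : q₁ ≠ q₂)
    (hc : ∀ q, q ≠ q₁ → q ≠ q₂ → c o q = 0) : rawSum N o c = c o q₁ + c o q₂ := by
  unfold rawSum
  exact sum_eq_add_of_mem q₁ q₂ (mem_range.2 (Nat.lt_succ_of_le h₁)) (mem_range.2 (Nat.lt_succ_of_le h₂)) hne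
    fun q _ hq => hc q hq.1 hq.2

/-- The core transport `shiftData n 0` acts columnwise and preserves 'no coefficient of order `≥ 2` in column `q`'. -/
theorem shiftData_zero_of_col_zero (n : ℚ) (c : ℕ → ℕ → ℚ) (q : ℕ) (hc : ∀ o, 2 ≤ o → c o q = 0) (o : ℕ)
    (ho : 2 ≤ o) : shiftData n 0 c o q = 0 := by
  have h0 := hc o ho
  have h1 := hc (o + 1) (by omega)
  have h2 := hc (o + 1 + 1) (by omega)
  unfold shiftData linMul
  split_ifs <;> simp [h0, h1, h2]

/-- **Single top pole of order 5.**  If the only column with coefficients of order `≥ 2` is `q₀` and its order is `5`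
(`c_{5,q₀} = 0`), then `Q = c_{4,q₀}² + (n − 2q₀)·c_{4,q₀}·c_{3,q₀}`. -/
theorem rawMinorQ_single_pole_five (N : ℕ) (n : ℚ) (c : ℕ → ℕ → ℚ) (q₀ : ℕ) (hq : q₀ ≤ N)
    (hoff : ∀ q, q ≠ q₀ → ∀ o, 2 ≤ o → c o q = 0) (h5 : c 5 q₀ = 0) :
    rawMinorQ N n c = c 4 q₀ ^ 2 + (n - 2 * q₀) * (c 4 q₀ * c 3 q₀) := by
  have hS : ∀ o, 2 ≤ o → rawSum N o c = c o q₀ := fun o ho =>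
    rawSum_eq_of_support_single hq fun q hq' => hoff q hq' o ho
  have hS' : ∀ o, 2 ≤ o → rawSum N o (shiftData n 0 c) = shiftData n 0 c o q₀ := fun o ho =>
    rawSum_eq_of_support_single hq fun q hq' => shiftData_zero_of_col_zero n c q (hoff q hq') o ho
  unfold rawMinorQ
  rw [hS 4 (by norm_num), hS 2 (by norm_num), hS' 4 (by norm_num), hS' 2 (by norm_num)]
  simp only [shiftData, linMul, h5, show (2:ℕ) < 5 from by norm_num, show (3:ℕ) < 5 from by norm_num,
    show (4:ℕ) < 5 from by norm_num, lt_self_iff_false, if_true, if_false]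
  push_cast
  ring

/-- On the polytope the lone top pole is the CENTRE column (`n = 2q₀`): then `Q = U²` (with `U = c_{4,q₀}`). -/
theorem rawMinorQ_single_centre_pole_five (N : ℕ) (n : ℚ) (c : ℕ → ℕ → ℚ) (q₀ : ℕ) (hq : q₀ ≤ N)
    (hoff : ∀ q, q ≠ q₀ → ∀ o, 2 ≤ o → c o q = 0) (h5 : c 5 q₀ = 0) (hcen : n = 2 * q₀) :
    rawMinorQ N n c = rawSum N 4 c ^ 2 := by
  rw [rawMinorQ_single_pole_five N n c q₀ hq hoff h5,
    rawSum_eq_of_support_single hq fun q hq' => hoff q hq' 4 (by norm_num), hcen]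
  ring

/-- **Mirror pair of order-6 poles.**  If the columns with coefficients of order `≥ 2` are `q₁ ≠ q₂` with `q₁ + q₂ = n`
and the reflection symmetry `c_{o,q₂} = (−1)^o c_{o,q₁}` (`2 ≤ o ≤ 5`), then
`Q = 4·(c_{4,q₁}² + (n − 2q₁)·(c_{3,q₁} c_{4,q₁} − c_{2,q₁} c_{5,q₁}))` — free of any even-jet entry beyond this combination. -/
theorem rawMinorQ_mirror_pair_six (N : ℕ) (n : ℚ) (c : ℕ → ℕ → ℚ) (q₁ q₂ : ℕ) (h₁ : q₁ ≤ N) (h₂ : q₂ ≤ N)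
    (hne : q₁ ≠ q₂) (hmir : (q₁ : ℚ) + q₂ = n) (hoff : ∀ q, q ≠ q₁ → q ≠ q₂ → ∀ o, 2 ≤ o → c o q = 0)
    (hsym : ∀ o, 2 ≤ o → o ≤ 5 → c o q₂ = (-1) ^ o * c o q₁) :
    rawMinorQ N n c = 4 * (c 4 q₁ ^ 2 + (n - 2 * q₁) * (c 3 q₁ * c 4 q₁ - c 2 q₁ * c 5 q₁)) := by
  have hS : ∀ o, 2 ≤ o → rawSum N o c = c o q₁ + c o q₂ := fun o ho =>
    rawSum_eq_of_support_pair h₁ h₂ hne fun q hq hq' => hoff q hq hq' o ho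
  have hS' : ∀ o, 2 ≤ o → rawSum N o (shiftData n 0 c) = shiftData n 0 c o q₁ + shiftData n 0 c o q₂ := fun o ho =>
    rawSum_eq_of_support_pair h₁ h₂ hne fun q hq hq' => shiftData_zero_of_col_zero n c q (hoff q hq hq') o ho
  have e2 := hsym 2 (by norm_num) (by norm_num)
  have e3 := hsym 3 (by norm_num) (by norm_num)
  have e4 := hsym 4 (by norm_num) (by norm_num)
  have e5 := hsym 5 (by norm_num) (by norm_num)
  have hq₂ : (q₂ : ℚ) = n - q₁ := by linarith
  unfold rawMinorQ
  rw [hS 4 (by norm_num), hS 2 (by norm_num), hS' 4 (by norm_num), hS' 2 (by norm_num)]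
  simp only [shiftData, linMul, show (2:ℕ) < 5 from by norm_num, show (3:ℕ) < 5 from by norm_num,
    show (4:ℕ) < 5 from by norm_num, lt_self_iff_false, if_true, if_false, e2, e3, e4, e5, hq₂]
  push_cast
  ring

/-- In the mirror-pair case `U = 2c_{4,q₁}` and the deflated sum satisfies `U·D = Q`, so
`2c_{4,q₁}·D = 4(c₄² + (n − 2q₁)(c₃c₄ − c₂c₅))` — the closed form behind `D/A = 2λ₁ + (4κ/3)λ₁² − 4κλ₃/λ₁`. -/
theorem rawSum_four_mirror_pair_six (N : ℕ) (c : ℕ → ℕ → ℚ) (q₁ q₂ : ℕ) (h₁ : q₁ ≤ N) (h₂ : q₂ ≤ N)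
    (hne : q₁ ≠ q₂) (hoff : ∀ q, q ≠ q₁ → q ≠ q₂ → ∀ o, 2 ≤ o → c o q = 0)
    (hsym : ∀ o, 2 ≤ o → o ≤ 5 → c o q₂ = (-1) ^ o * c o q₁) : rawSum N 4 c = 2 * c 4 q₁ := by
  rw [rawSum_eq_of_support_pair h₁ h₂ hne fun q hq hq' => hoff q hq hq' 4 (by norm_num),
    hsym 4 (by norm_num) (by norm_num)]
  ring

end WindowNormalForms

end Summit.KontsevichZagierPeriods.Zeta5Search.RVFlatGauge

end
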